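import Summits.PneNP.PneNP.Theorems.KarlinRubinMonotoneBlindCnf

/-!
# Route KarlinRubin, crux `MonotoneBlind` (stmt-PneNP-18027), line `Sketch`: stub `stub_blindAndDnf`, peeling count

Combinatorial core (no probability) of the stub `stub_blindAndDnf` (quiet ANDs of polynomially many polynomial-term
monotone DNFs are blind to the planted clique). A monotone DNF is its term family `D : Finset (Finset α)`; a point is
the finset `X` of slots that are on; `X` is DEAD if no term lies in `X`. The MISSING SETS of `X` are the `E \ X`,
`E ∈ D`; the MINIMAL missing sets are those not properly containing another missing set. A planted clique revives a
dead DNF only by covering a minimal missing set, so the revival probability of a dead point is governed by the number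
`N_b(X)` of minimal missing sets of size `≤ b`. This file bounds the `L`-th moment of `N_b` over dead points:

* `peel_count` — **peeling**: for any predicate `Good` with the one-step property (a nonempty removed set `J` always
  meets every complete term of `Z ∪ H` for some `H` inside the already-peeled set `R`), the `J ⊆ Z` with `#J ≤ t` and
  `Good (Z \ J) (J ∪ R)` number `≤ (2^B w + 1)^t` (terms of width `≤ w`, `#(J ∪ R) ≤ B`);
* `good_step` — unions of minimal missing sets have the one-step property (minimality forces the complete term to meet
  what is left of `J`);
* `sum_pow_minimal_le` — **moment bound**: `Σ_{X dead} N_b(X)^L ≤ 2^{|α|} (2^{bL} w + 1)^{bL} 2^{bL·L}`;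
* `pow_mul_card_minimal_ge_le` — Markov form: `u^L · #{X dead | u ≤ N_b(X)} ≤ 2^{|α|} (2^{bL} w + 1)^{bL} 2^{bL·L}`
  (restated at universe `0` as the registered helper stub `stub_blindAndDnfPeel`);
* `exists_minimal_missing_subset` — below every missing set lies a minimal one;
* `minimal_subset_minimal_narrow` — when wide terms miss many slots, small minimal missing sets come from narrow terms;
* `pow_mul_pow_le_of_le`, `card_filter_bool_le` — two elementary counting facts used by the probability layer.

All `--supports stmt-PneNP-18027`; no definitions (the predicates are written inline).
-/

set_option linter.dupNamespace false -- `Summit.PneNP.PneNP.…` is the layout-mandated namespace (D-0017)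

namespace Summit.PneNP.PneNP.Theorems.MonotoneBlind.VertexCover

open Finset

variable {α : Type*} [DecidableEq α]

/-! ### Two elementary counting facts -/

/-- Powers of a fraction `≤ 1` decrease: `d ≤ n`, `a ≤ v` give `d^v n^a ≤ d^a n^v`. [folklore] -/
theorem pow_mul_pow_le_of_le {d n a v : ℕ} (hdn : d ≤ n) (hav : a ≤ v) : d ^ v * n ^ a ≤ d ^ a * n ^ v := by
  obtain ⟨j, rfl⟩ := Nat.exists_eq_add_of_le hav
  rw [pow_add, pow_add]
  calc d ^ a * d ^ j * n ^ a = d ^ a * n ^ a * d ^ j := by ring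
    _ ≤ d ^ a * n ^ a * n ^ j := Nat.mul_le_mul_left _ (Nat.pow_le_pow_left hdn j)
    _ = d ^ a * (n ^ a * n ^ j) := by ring

/-- Bit vectors are determined by their sets of `true` slots: an event on bit vectors defined through that set has
at most as many points as the corresponding family of finsets. [folklore] -/
theorem card_filter_bool_le {ι : Type*} [Fintype ι] [DecidableEq ι] (P : Finset ι → Prop) [DecidablePred P] :
    #(univ.filter fun x : ι → Bool => P (univ.filter fun e => x e = true)) ≤ #(univ.filter P) := by
  refine card_le_card_of_injOn (fun x => univ.filter fun e => x e = true) (fun x hx => ?_) ?_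
  · rw [mem_coe, mem_filter] at hx
    exact mem_coe.2 (mem_filter.2 ⟨mem_univ _, hx.2⟩)
  · intro x _ x' _ h
    funext e
    have h' := congr_arg (fun s : Finset ι => e ∈ s) h
    simp only [mem_filter, mem_univ, true_and, eq_iff_iff] at h'
    exact Bool.eq_iff_iff.2 h'

/-! ### Two finset identities for peeling one slot -/

/-- Erasing a slot of `J ⊆ Z` from both leaves the difference unchanged. [folklore] -/
theorem erase_sdiff_erase_eq {Z J : Finset α} {e : α} (heJ : e ∈ J) :
    Z.erase e \ J.erase e = Z \ J := by
  ext a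
  by_cases hae : a = e
  · subst hae; simp [heJ]
  · simp [mem_sdiff, mem_erase, hae]

/-- Moving a slot of `J` into `R` leaves `J ∪ R` unchanged. [folklore] -/
theorem erase_union_insert_eq {J R : Finset α} {e : α} (heJ : e ∈ J) :
    J.erase e ∪ insert e R = J ∪ R := by
  ext a
  by_cases hae : a = e
  · subst hae; simp [heJ]
  · simp [mem_union, mem_erase, hae]

/-! ### Peeling -/

/-- **Peeling count.** Let every term of `D` have `≤ w` slots and let `Good X U` be a predicate with `#U ≤ B` and the
ONE-STEP PROPERTY: whenever `J ⊆ Z` is nonempty and `Good (Z \ J) (J ∪ R)`, some `H ⊆ R` makes `Z ∪ H` contain a term,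
and every term inside `Z ∪ H` meets `J`. Then for all `t, Z, R` the sets `J ⊆ Z` with `#J ≤ t` and
`Good (Z \ J) (J ∪ R)` number at most `(2^B w + 1)^t`: such a `J ≠ ∅` is `insert e J'` with `e` in a chosen complete
term of `Z ∪ H` (`≤ 2^B · w` choices of `(H, e)`) and `J'` counted by the same problem for `(Z.erase e, insert e R)`
and `t - 1`. [folklore] -/
theorem peel_count (D : Finset (Finset α)) (w B : ℕ) (hw : ∀ E ∈ D, #E ≤ w)
    (Good : Finset α → Finset α → Prop) (hGB : ∀ X U, Good X U → #U ≤ B)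
    (hstep : ∀ Z J R : Finset α, J ⊆ Z → J.Nonempty → Good (Z \ J) (J ∪ R) →
      ∃ H ⊆ R, (∃ E ∈ D, E ⊆ Z ∪ H) ∧ ∀ E ∈ D, E ⊆ Z ∪ H → ∃ e ∈ E, e ∈ J) :
    ∀ (t : ℕ) (Z R : Finset α) (S : Finset (Finset α)),
      (∀ J ∈ S, J ⊆ Z ∧ #J ≤ t ∧ Good (Z \ J) (J ∪ R)) → #S ≤ (2 ^ B * w + 1) ^ t := by
  classical
  -- a chosen complete term of an alive point (junk `∅` otherwise)
  let canon : Finset α → Finset α := fun Y => if h : ∃ E ∈ D, E ⊆ Y then h.choose else ∅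
  have hcanon : ∀ Y, (∃ E ∈ D, E ⊆ Y) → canon Y ∈ D ∧ canon Y ⊆ Y := fun Y h => by
    simp only [canon, dif_pos h]; exact h.choose_spec
  have hcanon_card : ∀ Y, #(canon Y) ≤ w := fun Y => by
    by_cases h : ∃ E ∈ D, E ⊆ Y
    · exact hw _ (hcanon Y h).1
    · simp only [canon, dif_neg h, card_empty]; exact Nat.zero_le _
  intro t
  induction t with
  | zero =>
    intro Z R S hS
    calc #S ≤ #({∅} : Finset (Finset α)) := by
          refine card_le_card fun J hJ => ?_
          rw [mem_singleton]
          exact card_eq_zero.1 (Nat.le_zero.1 (hS J hJ).2.1)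
      _ = (2 ^ B * w + 1) ^ 0 := by simp
  | succ t ih =>
    intro Z R S hS
    -- the sets `J.erase e`, `e ∈ J ∈ S`, are counted by the induction hypothesis
    set S' : α → Finset (Finset α) := fun e => (S.filter fun J => e ∈ J).image fun J => J.erase e with hS'
    have hS'le : ∀ e, #(S' e) ≤ (2 ^ B * w + 1) ^ t := by
      intro e
      refine ih (Z.erase e) (insert e R) (S' e) fun J' hJ' => ?_
      rw [hS', mem_image] at hJ'
      obtain ⟨J, hJ, rfl⟩ := hJ'
      rw [mem_filter] at hJ
      obtain ⟨hJS, heJ⟩ := hJ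
      obtain ⟨hJZ, hJt, hgood⟩ := hS J hJS
      refine ⟨erase_subset_erase e hJZ, ?_, ?_⟩
      · rw [card_erase_of_mem heJ]; omega
      · rw [erase_sdiff_erase_eq heJ, erase_union_insert_eq heJ]; exact hgood
    set T : α → Finset (Finset α) := fun e => (S' e).image (insert e) with hT
    -- the cover
    have hcover : S ⊆ {∅} ∪ R.powerset.biUnion fun H => (canon (Z ∪ H)).biUnion fun e => T e := by
      intro J hJS
      obtain ⟨hJZ, hJt, hgood⟩ := hS J hJS
      rw [mem_union, mem_singleton]
      rcases J.eq_empty_or_nonempty with rfl | hne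
      · exact Or.inl rfl
      right
      obtain ⟨H, hHR, halive, hmeet⟩ := hstep Z J R hJZ hne hgood
      obtain ⟨e, heC, heJ⟩ := hmeet _ (hcanon _ halive).1 (hcanon _ halive).2
      rw [mem_biUnion]
      refine ⟨H, mem_powerset.2 hHR, ?_⟩
      rw [mem_biUnion]
      refine ⟨e, heC, ?_⟩
      rw [hT, mem_image]
      refine ⟨J.erase e, ?_, insert_erase heJ⟩
      rw [hS']
      exact mem_image_of_mem _ (mem_filter.2 ⟨hJS, heJ⟩)
    -- counting
    rcases S.eq_empty_or_nonempty with hSe | ⟨J₀, hJ₀⟩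
    · rw [hSe, card_empty]; exact Nat.zero_le _
    have hRB : #R ≤ B := (card_le_card subset_union_right).trans (hGB _ _ (hS J₀ hJ₀).2.2)
    have hX : 1 ≤ (2 ^ B * w + 1) ^ t := Nat.one_le_pow _ _ (Nat.succ_pos _)
    calc #S ≤ #({∅} ∪ R.powerset.biUnion fun H => (canon (Z ∪ H)).biUnion fun e => T e) := card_le_card hcover
      _ ≤ #({∅} : Finset (Finset α)) + #(R.powerset.biUnion fun H => (canon (Z ∪ H)).biUnion fun e => T e) :=
          card_union_le _ _
      _ ≤ 1 + ∑ H ∈ R.powerset, ∑ e ∈ canon (Z ∪ H), #(T e) := by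
          rw [card_singleton]
          exact Nat.add_le_add_left (card_biUnion_le.trans (sum_le_sum fun H _ => card_biUnion_le)) 1
      _ ≤ 1 + ∑ H ∈ R.powerset, ∑ _e ∈ canon (Z ∪ H), (2 ^ B * w + 1) ^ t := by
          refine Nat.add_le_add_left (sum_le_sum fun H _ => sum_le_sum fun e _ => ?_) 1
          rw [hT]
          exact card_image_le.trans (hS'le e)
      _ = 1 + ∑ H ∈ R.powerset, #(canon (Z ∪ H)) * (2 ^ B * w + 1) ^ t := by
          simp_rw [sum_const, smul_eq_mul]
      _ ≤ 1 + ∑ _H ∈ R.powerset, w * (2 ^ B * w + 1) ^ t := by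
          refine Nat.add_le_add_left (sum_le_sum fun H _ => ?_) 1
          exact Nat.mul_le_mul_right _ (hcanon_card _)
      _ = 1 + 2 ^ #R * (w * (2 ^ B * w + 1) ^ t) := by rw [sum_const, smul_eq_mul, card_powerset]
      _ ≤ (2 ^ B * w + 1) ^ t + 2 ^ B * (w * (2 ^ B * w + 1) ^ t) :=
          add_le_add hX (Nat.mul_le_mul_right _ (Nat.pow_le_pow_right two_pos hRB))
      _ = (2 ^ B * w + 1) ^ (t + 1) := by ring

/-! ### Minimal missing sets -/

/-- **Below every missing set lies a minimal one.** For `E₀ ∈ D`, some `F = E \ X` (`E ∈ D`) with no missing set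
properly inside it satisfies `F ⊆ E₀ \ X` (take a missing set inside `E₀ \ X` of least size). [folklore] -/
theorem exists_minimal_missing_subset (D : Finset (Finset α)) (X : Finset α) {E₀ : Finset α} (hE₀ : E₀ ∈ D) :
    ∃ F : Finset α, (∃ E ∈ D, E \ X = F) ∧ (∀ E ∈ D, E \ X ⊆ F → E \ X = F) ∧ F ⊆ E₀ \ X := by
  classical
  set T := (D.image fun E => E \ X).filter fun F => F ⊆ E₀ \ X with hT
  have hne : T.Nonempty := ⟨E₀ \ X, mem_filter.2 ⟨mem_image_of_mem _ hE₀, Subset.rfl⟩⟩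
  obtain ⟨F, hFT, hFmin⟩ := exists_min_image T card hne
  rw [hT, mem_filter, mem_image] at hFT
  obtain ⟨⟨E, hED, hEF⟩, hFsub⟩ := hFT
  refine ⟨F, ⟨E, hED, hEF⟩, fun E' hE' hsub => ?_, hFsub⟩
  have hmem : E' \ X ∈ T := mem_filter.2 ⟨mem_image_of_mem _ hE', hsub.trans hFsub⟩
  exact eq_of_subset_of_card_le hsub (hFmin _ hmem)

/-- **Unions of minimal missing sets have the one-step property.** With
`Good X U := (X dead) ∧ Disjoint U X ∧ #U ≤ B ∧ (every slot of U lies in a minimal missing set of X inside U)`: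
if `J ⊆ Z` is nonempty and `Good (Z \ J) (J ∪ R)`, pick `a ∈ J` and a minimal missing set `F ∋ a` inside `J ∪ R`;
then `H := F \ J ⊆ R`, the term of `F` lies in `Z ∪ H`, and a term inside `Z ∪ H` missing `J` would have its missing
set inside `F \ J ⊊ F`, contradicting minimality. [folklore] -/
theorem good_step (D : Finset (Finset α)) (B : ℕ) (Z J R : Finset α) (hJZ : J ⊆ Z) (hne : J.Nonempty)
    (hgood : (∀ E ∈ D, ¬ E ⊆ Z \ J) ∧ Disjoint (J ∪ R) (Z \ J) ∧ #(J ∪ R) ≤ B ∧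
      ∀ a ∈ J ∪ R, ∃ F : Finset α, (∃ E ∈ D, E \ (Z \ J) = F) ∧
        (∀ E ∈ D, E \ (Z \ J) ⊆ F → E \ (Z \ J) = F) ∧ a ∈ F ∧ F ⊆ J ∪ R) :
    ∃ H ⊆ R, (∃ E ∈ D, E ⊆ Z ∪ H) ∧ ∀ E ∈ D, E ⊆ Z ∪ H → ∃ e ∈ E, e ∈ J := by
  classical
  obtain ⟨a, haJ⟩ := hne
  obtain ⟨F, ⟨E₀, hE₀D, hE₀F⟩, hmin, haF, hFU⟩ := hgood.2.2.2 a (mem_union_left _ haJ)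
  refine ⟨F \ J, fun b hb => ?_, ⟨E₀, hE₀D, fun b hb => ?_⟩, fun E hED hEsub => ?_⟩
  · rw [mem_sdiff] at hb
    rcases mem_union.1 (hFU hb.1) with h | h
    · exact absurd h hb.2
    · exact h
  · rw [mem_union]
    by_cases hbX : b ∈ Z \ J
    · exact Or.inl (mem_sdiff.1 hbX).1
    · have hbF : b ∈ F := by rw [← hE₀F]; exact mem_sdiff.2 ⟨hb, hbX⟩
      by_cases hbJ : b ∈ J
      · exact Or.inl (hJZ hbJ)
      · exact Or.inr (mem_sdiff.2 ⟨hbF, hbJ⟩)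
  · by_contra hcon
    push Not at hcon
    have hsub : E \ (Z \ J) ⊆ F := by
      intro b hb
      rw [mem_sdiff] at hb
      rcases mem_union.1 (hEsub hb.1) with hbZ | hbH
      · exact absurd (mem_sdiff.2 ⟨hbZ, fun hbJ => hcon b hb.1 hbJ⟩) hb.2
      · exact (mem_sdiff.1 hbH).1
    have heq := hmin E hED hsub
    have haE : a ∈ E := by
      rw [← heq] at haF
      exact (mem_sdiff.1 haF).1
    exact hcon a haE haJ

/-- **Narrowing.** If every term with more than `W` slots misses more than `B ≥ b` slots of `X`, the minimal missing
sets of size `≤ b` of `D` at `X` are minimal missing sets of the NARROW sub-family (terms with `≤ W` slots).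
(`Fintype α` is assumed only so that the decidability instances of the statement agree with the users'.)
[folklore] -/
theorem minimal_subset_minimal_narrow [Fintype α] (D : Finset (Finset α)) (X : Finset α) (W B b : ℕ) (hbB : b ≤ B)
    (hnw : ∀ E ∈ D, W < #E → B < #(E \ X)) :
    ((D.image fun E => E \ X).filter fun F => (∀ E ∈ D, E \ X ⊆ F → E \ X = F) ∧ #F ≤ b) ⊆
      (((D.filter fun E => #E ≤ W).image fun E => E \ X).filter fun F =>
        (∀ E ∈ D.filter (fun E => #E ≤ W), E \ X ⊆ F → E \ X = F) ∧ #F ≤ b) := by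
  intro F hF
  rw [mem_filter, mem_image] at hF
  obtain ⟨⟨E, hED, hEF⟩, hmin, hFb⟩ := hF
  rw [mem_filter, mem_image]
  refine ⟨⟨E, mem_filter.2 ⟨hED, ?_⟩, hEF⟩, fun E' hE' h => hmin E' (mem_filter.1 hE').1 h, hFb⟩
  by_contra hW
  have h := hnw E hED (not_le.1 hW)
  rw [hEF] at h
  omega

/-! ### The moment bound -/

/-- **Moment bound for minimal missing sets.** If every term of `D` has `≤ w` slots then, summing over the dead points
`X`, the `L`-th power of the number `N_b(X)` of minimal missing sets of size `≤ b` is at most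
`2^{|α|} · (2^{bL} w + 1)^{bL} · 2^{bL·L}`: an `L`-tuple of such sets at `X` has union `U` with `#U ≤ bL`, the pair
`(X, U)` is `Good`, so `(X, tuple) = (Z \ J, tuple ⊆ J)` with `Z = X ∪ U` and `J = U` counted by `peel_count`.
[folklore] -/
theorem sum_pow_minimal_le [Fintype α] (D : Finset (Finset α)) (w b L : ℕ) (hw : ∀ E ∈ D, #E ≤ w) :
    ∑ X ∈ (univ : Finset (Finset α)).filter (fun X => ∀ E ∈ D, ¬ E ⊆ X),
      #((D.image fun E => E \ X).filter fun F =>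
          (∀ E ∈ D, E \ X ⊆ F → E \ X = F) ∧ #F ≤ b) ^ L ≤
      2 ^ Fintype.card α * ((2 ^ (b * L) * w + 1) ^ (b * L) * 2 ^ (b * L * L)) := by
  classical
  set B := b * L with hB
  set MFb : Finset α → Finset (Finset α) := fun X =>
    (D.image fun E => E \ X).filter fun F => (∀ E ∈ D, E \ X ⊆ F → E \ X = F) ∧ #F ≤ b with hMFb
  let Good : Finset α → Finset α → Prop := fun X U =>
    (∀ E ∈ D, ¬ E ⊆ X) ∧ Disjoint U X ∧ #U ≤ B ∧
      ∀ a ∈ U, ∃ F : Finset α, (∃ E ∈ D, E \ X = F) ∧ (∀ E ∈ D, E \ X ⊆ F → E \ X = F) ∧ a ∈ F ∧ F ⊆ U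
  set Sset : Finset α → Finset (Finset α) := fun Z =>
    Z.powerset.filter fun J => #J ≤ B ∧ Good (Z \ J) (J ∪ ∅) with hSset
  have hpeel : ∀ Z, #(Sset Z) ≤ (2 ^ B * w + 1) ^ B := fun Z =>
    peel_count D w B hw Good (fun X U h => h.2.2.1) (fun Z J R hJZ hne hg => good_step D B Z J R hJZ hne hg) B Z ∅
      (Sset Z) fun J hJ => by
        rw [hSset, mem_filter, mem_powerset] at hJ
        exact ⟨hJ.1, hJ.2.1, hJ.2.2⟩
  set Dead := (univ : Finset (Finset α)).filter fun X => ∀ E ∈ D, ¬ E ⊆ X with hDead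
  set Dom : Finset (Finset α × (Fin L → Finset α)) :=
    Dead.biUnion fun X => (Fintype.piFinset fun _ : Fin L => MFb X).image (Prod.mk X) with hDom
  set Cod : Finset (Finset α × (Fin L → Finset α)) :=
    (univ : Finset (Finset α)).biUnion fun Z => (Sset Z).biUnion fun J =>
      (Fintype.piFinset fun _ : Fin L => J.powerset).image fun τ => (Z \ J, τ) with hCod
  -- the sum is `#Dom`
  have hDomcard : #Dom = ∑ X ∈ Dead, #(MFb X) ^ L := by
    rw [hDom, card_biUnion]
    · refine sum_congr rfl fun X _ => ?_
      rw [card_image_of_injective _ (Prod.mk_right_injective X), Fintype.card_piFinset_const]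
    · intro X _ X' _ hXX'
      simp only [Function.onFun]
      rw [disjoint_left]
      intro p hp hp'
      rw [mem_image] at hp hp'
      obtain ⟨τ, -, rfl⟩ := hp
      obtain ⟨τ', -, h⟩ := hp'
      exact hXX' (Prod.ext_iff.1 h).1.symm
  -- `Dom ⊆ Cod`
  have hsub : Dom ⊆ Cod := by
    intro p hp
    rw [hDom, mem_biUnion] at hp
    obtain ⟨X, hX, hp⟩ := hp
    rw [mem_image] at hp
    obtain ⟨τ, hτ, rfl⟩ := hp
    rw [hDead, mem_filter] at hX
    rw [Fintype.mem_piFinset] at hτ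
    set U := (univ : Finset (Fin L)).biUnion τ with hU
    -- facts about the tuple
    have hτX : ∀ l, Disjoint (τ l) X := fun l => by
      have h := (mem_filter.1 (hτ l)).1
      rw [mem_image] at h
      obtain ⟨E, -, hE⟩ := h
      rw [← hE]
      exact sdiff_disjoint
    have hUX : Disjoint U X := by
      rw [hU, disjoint_biUnion_left]
      exact fun l _ => hτX l
    have hUcard : #U ≤ B := by
      calc #U ≤ ∑ l, #(τ l) := card_biUnion_le
        _ ≤ ∑ _l : Fin L, b := sum_le_sum fun l _ => (mem_filter.1 (hτ l)).2.2
        _ = B := by rw [sum_const, card_univ, Fintype.card_fin, smul_eq_mul, hB, mul_comm]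
    have hgood : Good X U := by
      refine ⟨hX.2, hUX, hUcard, fun a ha => ?_⟩
      rw [hU, mem_biUnion] at ha
      obtain ⟨l, -, hal⟩ := ha
      have h := mem_filter.1 (hτ l)
      exact ⟨τ l, mem_image.1 h.1, h.2.1, hal, subset_biUnion_of_mem τ (mem_univ l)⟩
    have hZJ : (X ∪ U) \ U = X := by
      rw [union_sdiff_right, Finset.sdiff_eq_self_iff_disjoint]
      exact hUX.symm
    rw [hCod, mem_biUnion]
    refine ⟨X ∪ U, mem_univ _, ?_⟩
    rw [mem_biUnion]
    refine ⟨U, ?_, ?_⟩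
    · rw [hSset, mem_filter, mem_powerset]
      refine ⟨subset_union_right, hUcard, ?_⟩
      rw [hZJ, union_empty]
      exact hgood
    · rw [mem_image]
      refine ⟨τ, ?_, by rw [hZJ]⟩
      rw [Fintype.mem_piFinset]
      exact fun l => mem_powerset.2 (subset_biUnion_of_mem τ (mem_univ l))
  -- `#Cod` is small
  have hCodcard : #Cod ≤ 2 ^ Fintype.card α * ((2 ^ B * w + 1) ^ B * 2 ^ (B * L)) := by
    calc #Cod ≤ ∑ Z : Finset α, #((Sset Z).biUnion fun J =>
            (Fintype.piFinset fun _ : Fin L => J.powerset).image fun τ => (Z \ J, τ)) := card_biUnion_le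
      _ ≤ ∑ Z : Finset α, ∑ J ∈ Sset Z,
            #((Fintype.piFinset fun _ : Fin L => J.powerset).image fun τ => (Z \ J, τ)) :=
          sum_le_sum fun Z _ => card_biUnion_le
      _ ≤ ∑ Z : Finset α, ∑ _J ∈ Sset Z, 2 ^ (B * L) := by
          refine sum_le_sum fun Z _ => sum_le_sum fun J hJ => ?_
          have hJB : #J ≤ B := (mem_filter.1 hJ).2.1
          calc #((Fintype.piFinset fun _ : Fin L => J.powerset).image fun τ => (Z \ J, τ))
              ≤ #(Fintype.piFinset fun _ : Fin L => J.powerset) := card_image_le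
            _ = (2 ^ #J) ^ L := by rw [Fintype.card_piFinset_const, card_powerset]
            _ ≤ (2 ^ B) ^ L := Nat.pow_le_pow_left (Nat.pow_le_pow_right two_pos hJB) L
            _ = 2 ^ (B * L) := (pow_mul 2 B L).symm
      _ = ∑ Z : Finset α, #(Sset Z) * 2 ^ (B * L) := by simp_rw [sum_const, smul_eq_mul]
      _ ≤ ∑ _Z : Finset α, (2 ^ B * w + 1) ^ B * 2 ^ (B * L) :=
          sum_le_sum fun Z _ => Nat.mul_le_mul_right _ (hpeel Z)
      _ = 2 ^ Fintype.card α * ((2 ^ B * w + 1) ^ B * 2 ^ (B * L)) := by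
          rw [sum_const, card_univ, Fintype.card_finset, smul_eq_mul]
  calc ∑ X ∈ Dead, #(MFb X) ^ L = #Dom := hDomcard.symm
    _ ≤ #Cod := card_le_card hsub
    _ ≤ _ := hCodcard

/-- **Markov form of the moment bound.** With `N_b(X)` as above and every term of width `≤ w`:
`u^L · #{X dead | u ≤ N_b(X)} ≤ 2^{|α|} (2^{bL} w + 1)^{bL} 2^{bL·L}`. [folklore] -/
theorem pow_mul_card_minimal_ge_le [Fintype α] (D : Finset (Finset α)) (w b L u : ℕ) (hw : ∀ E ∈ D, #E ≤ w) :
    u ^ L * #((univ : Finset (Finset α)).filter fun X => (∀ E ∈ D, ¬ E ⊆ X) ∧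
        u ≤ #((D.image fun E => E \ X).filter fun F => (∀ E ∈ D, E \ X ⊆ F → E \ X = F) ∧ #F ≤ b)) ≤
      2 ^ Fintype.card α * ((2 ^ (b * L) * w + 1) ^ (b * L) * 2 ^ (b * L * L)) := by
  classical
  set Bad := (univ : Finset (Finset α)).filter fun X => (∀ E ∈ D, ¬ E ⊆ X) ∧
      u ≤ #((D.image fun E => E \ X).filter fun F => (∀ E ∈ D, E \ X ⊆ F → E \ X = F) ∧ #F ≤ b) with hBad
  refine le_trans ?_ (sum_pow_minimal_le D w b L hw)
  calc u ^ L * #Bad = ∑ _X ∈ Bad, u ^ L := by rw [sum_const, smul_eq_mul, mul_comm]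
    _ ≤ ∑ X ∈ Bad, #((D.image fun E => E \ X).filter fun F =>
          (∀ E ∈ D, E \ X ⊆ F → E \ X = F) ∧ #F ≤ b) ^ L := by
        refine sum_le_sum fun X hX => ?_
        rw [hBad, mem_filter] at hX
        exact Nat.pow_le_pow_left hX.2.2 L
    _ ≤ _ := by
        refine sum_le_sum_of_subset_of_nonneg (fun X hX => ?_) fun _ _ _ => Nat.zero_le _
        rw [hBad, mem_filter] at hX
        exact mem_filter.2 ⟨mem_univ _, hX.2.1⟩

/-! ### The registered helper stub -/

/-- **stub_blindAndDnfPeel** (registered helper stub of `stub_blindAndDnf`, crux stmt-PneNP-18027): the Markov form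
of the moment bound (`pow_mul_card_minimal_ge_le`) at universe level `0` — for term families of width `≤ w`,
`u^L · #{X dead | u ≤ N_b(X)} ≤ 2^{|α|} (2^{bL} w + 1)^{bL} 2^{bL·L}`. [folklore] -/
theorem stub_blindAndDnfPeel :
    ∀ {α : Type} [DecidableEq α] [Fintype α] (D : Finset (Finset α)) (w b L u : ℕ), (∀ E ∈ D, #E ≤ w) → u ^ L *
    #((univ : Finset (Finset α)).filter fun X => (∀ E ∈ D, ¬ E ⊆ X) ∧ u ≤ #((D.image fun E => E \ X).filter fun
    F => (∀ E ∈ D, E \ X ⊆ F → E \ X = F) ∧ #F ≤ b)) ≤ 2 ^ Fintype.card α * ((2 ^ (b * L) * w + 1) ^ (b * L) * 2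
    ^ (b * L * L)) :=
  fun D w b L u hw => pow_mul_card_minimal_ge_le D w b L u hw

end Summit.PneNP.PneNP.Theorems.MonotoneBlind.VertexCover
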